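import Summits.HodgeConjecture.HodgeConjecture.Theorems.NikulinTwinTransportTwinSimilitudeAlgebraicHKDefs
import Literature.AlgebraicGeometry.Hyperkaehler.K3HilbertType
import Literature.AlgebraicGeometry.Surfaces.K3NikulinInvolution
import Literature.AlgebraicGeometry.Surfaces.K3SurfaceProofs
import Mathlib.LinearAlgebra.LinearIndependent.BaseChange
import Mathlib.LinearAlgebra.BilinearForm.Orthogonal
import HarnessLib

/-!
# Route NikulinTwinTransport · crux `TwinSimilitudeAlgebraic` (stmt-HodgeConjecture-13674) —
# stub `stub_hkLatticeWitt` of line `hyperkaehler-nikulin-anchors` (reshape r2): lattice helpers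

Linear algebra of the `K3^{[2]}` lattice `Λ_{K3} ⊕ ⟨−2⟩` (the tree's `k3HilbertGram 2`,
`k3HilbertForm 2` on `K3HilbertIndex = K3Index ⊕ Unit`) used by the stub file
`NikulinTwinTransportTwinSimilitudeAlgebraicStubHkLatticeWitt`.  The file introduces NO
definitions and NO notation: the rational form is written `Matrix.toBilin' (Λ₂₃.map Int.cast)`
with `Λ₂₃ = k3HilbertGram 2`, and `inl v = Sum.elim v 0`.

* `qRat_*` — the rational form `q` on `ℚ²³`: symmetric and NON-DEGENERATE (`det = 2`,
  `k3HilbertGram_two_det`), with its casts to `ℂ²³` and `ℤ²³`; `qRat_sumElim`: `v ↦ (v, 0)` is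
  isometric;
* `funLeft_host_of_matrix`, `exists_hostEmb` — the HOST `N = U³ ⊕ E₈(−2) ⊕ ⟨−2⟩`
  (`hostGram`) embeds into `ℚ²³` by `U³ ↦ U³`, `E₈(−2) ∋ w ↦ (w, w)` diagonally in `E₈(−1)²`,
  `⟨−2⟩ ↦ δ`: injective, ISOMETRIC (the integer matrix identity `Pᵀ Λ₂₃ P = N`, kernel-checked by
  `decide`) and with image invariant under the block swap `I = Sum.map k3BlockSwap id` —
  Mongardi's invariant lattice of a symplectic involution on a `K3^{[2]}`-type fourfold;
* `toMatrix_conj_eq`, `k3HilbertForm_mulVec_mulVec` — a rational isometry of `q` is a matrix `M`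
  with `Mᵀ Λ₂₃ M = Λ₂₃`, hence preserves the complex form on `ℂ²³`; rational matrices are real
  (`star_map_ratCast_mulVec`);
* `mem_span_trRat` — **a period `x ∈ Λ_ℂ` lies in `T_x ⊗ ℂ`**, `T_x = trRat x = (nsRat x)^⊥`:
  orthogonals of the non-degenerate K3 form commute with `⊗_ℚ ℂ` (dimension count,
  `finrank_span_ratCast`).

Sources: G. Mongardi, Cent. Eur. J. Math. 10 (2012) Thm. 5.2, §2 Ex. 2.2; D. Huybrechts,
*Lectures on K3 Surfaces*, Ch. 3 Def. 2.5 / Lemma 3.1 and Ch. 14 §0.3. Prover seat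
prover-line-stmt-HodgeConjecture-13674-c1-0 (stub worker, stub `stub_hkLatticeWitt`).
-/

noncomputable section

set_option linter.dupNamespace false

open scoped Matrix
open Module
open Literature.AlgebraicGeometry.Surfaces Literature.AlgebraicGeometry.Hyperkaehler

namespace Summit.HodgeConjecture.HodgeConjecture.Theorems.NikulinTwinTransport.HkLatticeWitt

/-! ### The rational `K3^{[2]}` form `q = Matrix.toBilin' (Λ₂₃ ⊗ ℚ)` on `ℚ²³` -/

/-- The defining double sum of `q`. [folklore] -/
theorem qRat_apply (a b : K3HilbertIndex → ℚ) :
    Matrix.toBilin' ((k3HilbertGram 2).map (Int.cast : ℤ → ℚ)) a b =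
      ∑ i, ∑ j, a i * (k3HilbertGram 2 i j : ℚ) * b j := by
  rw [Matrix.toBilin'_apply]
  rfl

/-- The complex `K3^{[2]}` form restricted to `ℚ²³ ⊂ ℂ²³` is `q`. [folklore] -/
theorem k3HilbertForm_ratCast (a b : K3HilbertIndex → ℚ) :
    k3HilbertForm 2 (fun i => (a i : ℂ)) (fun i => (b i : ℂ)) =
      ((Matrix.toBilin' ((k3HilbertGram 2).map (Int.cast : ℤ → ℚ)) a b : ℚ) : ℂ) := by
  rw [qRat_apply]
  simp only [k3HilbertForm, Rat.cast_sum, Rat.cast_mul, Rat.cast_intCast]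

/-- `q` restricted to `ℤ²³` is the integral lattice form. [folklore] -/
theorem qRat_intCast (v w : K3HilbertIndex → ℤ) :
    Matrix.toBilin' ((k3HilbertGram 2).map (Int.cast : ℤ → ℚ)) (fun i => (v i : ℚ)) (fun i => (w i : ℚ)) =
      ((∑ i, ∑ j, v i * k3HilbertGram 2 i j * w j : ℤ) : ℚ) := by
  rw [qRat_apply]
  simp only [Int.cast_sum, Int.cast_mul]

/-- The rational Gram matrix is symmetric. [folklore] -/
theorem gramQ_transpose :
    ((k3HilbertGram 2).map (Int.cast : ℤ → ℚ))ᵀ = (k3HilbertGram 2).map (Int.cast : ℤ → ℚ) := by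
  rw [← Matrix.transpose_map, k3HilbertGram_transpose]

/-- `q` is symmetric. [folklore] -/
theorem qRat_isSymm : (Matrix.toBilin' ((k3HilbertGram 2).map (Int.cast : ℤ → ℚ))).IsSymm := by
  refine ⟨fun a b => ?_⟩
  show Matrix.toBilin' _ a b = Matrix.toBilin' _ b a
  rw [Matrix.toBilin'_apply', Matrix.toBilin'_apply', Matrix.dotProduct_mulVec, dotProduct_comm,
    ← Matrix.mulVec_transpose, gramQ_transpose]

/-- `det (Λ_{K3} ⊕ ⟨−2⟩) = (−1) · (−2) = 2`. [cite: Huybrechts2016K3, Ch. 14 §0.3 (vi)] -/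
theorem k3HilbertGram_two_det : (k3HilbertGram 2).det = 2 := by
  rw [k3HilbertGram, Matrix.det_fromBlocks_zero₂₁, k3Gram_det, Matrix.det_unique, Matrix.of_apply]
  norm_num

/-- **`q` is non-degenerate on `ℚ²³`** (`det = 2 ≠ 0`).
[cite: Huybrechts2016K3, Ch. 14 §0.3 (vi)] -/
theorem qRat_nondegenerate :
    (Matrix.toBilin' ((k3HilbertGram 2).map (Int.cast : ℤ → ℚ))).Nondegenerate := by
  refine LinearMap.BilinForm.nondegenerate_toBilin'_of_det_ne_zero' _ ?_
  rw [← Int.cast_det, k3HilbertGram_two_det]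
  norm_num

/-! ### `inl : v ↦ (v, 0) = Sum.elim v 0` -/

/-- `inl` commutes with `ℚ ⊂ ℂ`. [folklore] -/
theorem ratCast_sumElim (v : K3Index → ℚ) :
    (fun i => ((Sum.elim v (0 : Unit → ℚ) i : ℚ) : ℂ)) = Sum.elim (fun i => (v i : ℂ)) 0 := by
  funext i
  rcases i with i | i <;> simp

/-- `inl` is isometric: `q((v,0), (w,0)) = (v.w)`. [cite: Mongardi2011, §2 Example 2.2] -/
theorem qRat_sumElim (v w : K3Index → ℚ) :
    Matrix.toBilin' ((k3HilbertGram 2).map (Int.cast : ℤ → ℚ)) (Sum.elim v 0) (Sum.elim w 0) =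
      k3FormRat v w := by
  apply Rat.cast_injective (α := ℂ)
  rw [← k3HilbertForm_ratCast, ← k3Form_ratCast, ratCast_sumElim, ratCast_sumElim, k3HilbertForm_inl]

/-! ### The host `N = U³ ⊕ E₈(−2) ⊕ ⟨−2⟩` inside `Λ_{K3} ⊕ ⟨−2⟩` -/

/-- **An index map `π : (23 indices) → (15 indices)` whose `0/1` matrix `P` satisfies
`Pᵀ Λ₂₃ P = N` defines an injective isometric embedding `h ↦ h ∘ π` of the rational host
`N_ℚ` into `ℚ²³`** (`π` onto). [cite: Mongardi2011, Thm. 5.2] -/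
theorem funLeft_host_of_matrix (π : K3HilbertIndex → HostIndex) (hπ : Function.Surjective π)
    (hP : (Matrix.of fun i a => if π i = a then (1 : ℤ) else 0)ᵀ * k3HilbertGram 2 *
      (Matrix.of fun i a => if π i = a then (1 : ℤ) else 0) = hostGram) :
    Function.Injective (LinearMap.funLeft ℚ ℚ π) ∧
      ∀ h h' : HostIndex → ℚ, Matrix.toBilin' ((k3HilbertGram 2).map (Int.cast : ℤ → ℚ))
        (LinearMap.funLeft ℚ ℚ π h) (LinearMap.funLeft ℚ ℚ π h') = hostFormRat h h' := by
  refine ⟨LinearMap.funLeft_injective_of_surjective ℚ ℚ π hπ, fun h h' => ?_⟩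
  set P : Matrix K3HilbertIndex HostIndex ℤ := Matrix.of fun i a => if π i = a then (1 : ℤ) else 0
    with hPdef
  have hq : (P.map (Int.cast : ℤ → ℚ))ᵀ * (k3HilbertGram 2).map (Int.cast : ℤ → ℚ) *
      P.map (Int.cast : ℤ → ℚ) = hostGram.map (Int.cast : ℤ → ℚ) := by
    have h := congrArg (fun A : Matrix HostIndex HostIndex ℤ => A.map (Int.castRingHom ℚ)) hP
    rw [Matrix.map_mul, Matrix.map_mul, Matrix.transpose_map, Int.coe_castRingHom] at h
    exact h
  have hPv : ∀ g : HostIndex → ℚ, P.map (Int.cast : ℤ → ℚ) *ᵥ g = LinearMap.funLeft ℚ ℚ π g := by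
    intro g
    funext i
    rw [LinearMap.funLeft_apply, hPdef]
    show _ = g (π i)
    simp only [Matrix.mulVec, dotProduct, Matrix.map_apply, Matrix.of_apply, Int.cast_ite,
      Int.cast_one, Int.cast_zero, ite_mul, one_mul, zero_mul, Finset.sum_ite_eq, Finset.mem_univ,
      if_true]
  rw [Matrix.toBilin'_apply', ← hPv, ← hPv, hostFormRat, Matrix.toBilin'_apply', ← hq,
    ← Matrix.vecMul_transpose (P.map (Int.cast : ℤ → ℚ)) h]
  simp only [Matrix.dotProduct_mulVec, Matrix.vecMul_vecMul, Matrix.mul_assoc]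

/-- **The host embedding.**  There is an injective `ℚ`-linear `E : N_ℚ → ℚ²³`, ISOMETRIC for
`hostFormRat` and `q`, whose image is pointwise fixed by the block swap `I = Sum.map k3BlockSwap id`
of the two `E₈(−1)` blocks: `E(h) = h ∘ π` with `π` sending both `E₈(−1)` blocks to the `E₈(−2)`
coordinates (`w ↦ (w, w)`, form `2·(−E₈) = −2E₈`), `U³ ↦ U³`, `δ ↦ ⟨−2⟩`; the isometry is the
integer matrix identity `Pᵀ Λ₂₃ P = N`, kernel-checked. [cite: Mongardi2011, Thm. 5.2] -/
theorem exists_hostEmb :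
    ∃ E : (HostIndex → ℚ) →ₗ[ℚ] (K3HilbertIndex → ℚ), Function.Injective E ∧
      (∀ h h' : HostIndex → ℚ, Matrix.toBilin' ((k3HilbertGram 2).map (Int.cast : ℤ → ℚ))
        (E h) (E h') = hostFormRat h h') ∧
      ∀ (h : HostIndex → ℚ) (i : K3HilbertIndex), E h (Sum.map k3BlockSwap id i) = E h i := by
  obtain ⟨hinj, hiso⟩ := funLeft_host_of_matrix
    (Sum.elim (Sum.elim (Sum.elim (Sum.inr ∘ Sum.inl) (Sum.inr ∘ Sum.inl)) Sum.inl)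
      (fun _ => Sum.inr (Sum.inr 0)))
    (by
      intro a
      rcases a with k | i | t
      · exact ⟨Sum.inl (Sum.inr k), rfl⟩
      · exact ⟨Sum.inl (Sum.inl (Sum.inl i)), rfl⟩
      · exact ⟨Sum.inr (),
          congrArg (fun s : Fin 1 => (Sum.inr (Sum.inr s) : HostIndex)) (Subsingleton.elim 0 t)⟩)
    (by decide)
  exact ⟨_, hinj, hiso, fun h i => by rcases i with ((i | i) | i) | i <;> rfl⟩

/-! ### Rational isometries as matrices, and their complexification -/

/-- An isometry of `q` has `Mᵀ Λ₂₃ M = Λ₂₃`. [folklore] -/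
theorem toMatrix_conj_eq {τ : (K3HilbertIndex → ℚ) →ₗ[ℚ] (K3HilbertIndex → ℚ)}
    (hτ : ∀ v w, Matrix.toBilin' ((k3HilbertGram 2).map (Int.cast : ℤ → ℚ)) (τ v) (τ w) =
      Matrix.toBilin' ((k3HilbertGram 2).map (Int.cast : ℤ → ℚ)) v w) :
    (LinearMap.toMatrix' τ)ᵀ * (k3HilbertGram 2).map (Int.cast : ℤ → ℚ) * LinearMap.toMatrix' τ =
      (k3HilbertGram 2).map (Int.cast : ℤ → ℚ) := by
  refine Matrix.toBilin'.injective (LinearMap.BilinForm.ext fun v w => ?_)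
  rw [Matrix.toBilin'_apply', Matrix.toBilin'_apply']
  have h := hτ v w
  rw [Matrix.toBilin'_apply', Matrix.toBilin'_apply', ← LinearMap.toMatrix'_mulVec τ v,
    ← LinearMap.toMatrix'_mulVec τ w, ← Matrix.vecMul_transpose (LinearMap.toMatrix' τ) v] at h
  simp only [Matrix.dotProduct_mulVec, Matrix.vecMul_vecMul, Matrix.mul_assoc] at h ⊢
  exact h

/-- The complex `K3^{[2]}` form in matrix terms. [folklore] -/
theorem k3HilbertForm_eq_dotProduct (a b : K3HilbertIndex → ℂ) :
    k3HilbertForm 2 a b = a ⬝ᵥ ((k3HilbertGram 2).map (Int.cast : ℤ → ℂ) *ᵥ b) := by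
  simp only [k3HilbertForm, dotProduct, Matrix.mulVec, Matrix.map_apply, Finset.mul_sum, mul_assoc]

/-- `Λ₂₃ ⊗ ℚ ⊗ ℂ = Λ₂₃ ⊗ ℂ`. [folklore] -/
theorem gramQ_map_ratCast :
    ((k3HilbertGram 2).map (Int.cast : ℤ → ℚ)).map (fun q : ℚ => (q : ℂ)) =
      (k3HilbertGram 2).map (Int.cast : ℤ → ℂ) := by
  rw [Matrix.map_map]
  congr 1

/-- **A rational isometry of `q` preserves the complex form** (`Mᵀ Λ₂₃ M = Λ₂₃` cast to `ℂ`).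
[cite: Huybrechts2016K3, Ch. 6 §1.1] -/
theorem k3HilbertForm_mulVec_mulVec {M : Matrix K3HilbertIndex K3HilbertIndex ℚ}
    (hM : Mᵀ * (k3HilbertGram 2).map (Int.cast : ℤ → ℚ) * M = (k3HilbertGram 2).map (Int.cast : ℤ → ℚ))
    (a b : K3HilbertIndex → ℂ) :
    k3HilbertForm 2 (M.map (fun q : ℚ => (q : ℂ)) *ᵥ a) (M.map (fun q : ℚ => (q : ℂ)) *ᵥ b) =
      k3HilbertForm 2 a b := by
  have hC : (M.map (fun q : ℚ => (q : ℂ)))ᵀ * (k3HilbertGram 2).map (Int.cast : ℤ → ℂ) *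
      M.map (fun q : ℚ => (q : ℂ)) = (k3HilbertGram 2).map (Int.cast : ℤ → ℂ) := by
    have h := congrArg (fun A : Matrix K3HilbertIndex K3HilbertIndex ℚ => A.map (Rat.castHom ℂ)) hM
    rw [Matrix.map_mul, Matrix.map_mul, Matrix.transpose_map, Rat.coe_castHom] at h
    rw [← gramQ_map_ratCast]
    exact h
  rw [k3HilbertForm_eq_dotProduct, k3HilbertForm_eq_dotProduct,
    ← Matrix.vecMul_transpose (M.map _) a]
  simp only [Matrix.dotProduct_mulVec, Matrix.vecMul_vecMul, hC]

/-- Rational matrices map rational vectors to rational vectors. [folklore] -/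
theorem map_ratCast_mulVec_ratCast (M : Matrix K3HilbertIndex K3HilbertIndex ℚ)
    (a : K3HilbertIndex → ℚ) :
    M.map (fun q : ℚ => (q : ℂ)) *ᵥ (fun i => (a i : ℂ)) = fun i => ((M *ᵥ a) i : ℂ) := by
  funext i
  simp only [Matrix.mulVec, dotProduct, Matrix.map_apply, Rat.cast_sum, Rat.cast_mul]

/-- A rational matrix is REAL: it commutes with complex conjugation. [folklore] -/
theorem star_map_ratCast_mulVec (M : Matrix K3HilbertIndex K3HilbertIndex ℚ)
    (v : K3HilbertIndex → ℂ) :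
    star (M.map (fun q : ℚ => (q : ℂ)) *ᵥ v) = M.map (fun q : ℚ => (q : ℂ)) *ᵥ star v := by
  funext i
  simp only [Pi.star_apply, Matrix.mulVec, dotProduct, Matrix.map_apply, star_sum, star_mul',
    Complex.star_def, map_ratCast]

/-- `\overline{(x, 0)} = (x̄, 0)`. [folklore] -/
theorem star_sumElim (x : K3Index → ℂ) :
    star (Sum.elim x 0 : K3HilbertIndex → ℂ) = Sum.elim (star x) 0 := by
  funext i
  rcases i with i | i <;> simp

/-- `q((c • a), b) = c · q(a, b)` over `ℂ`. [folklore] -/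
theorem k3HilbertForm_smul_left (c : ℂ) (a b : K3HilbertIndex → ℂ) :
    k3HilbertForm 2 (c • a) b = c * k3HilbertForm 2 a b := by
  rw [k3HilbertForm_eq_dotProduct, k3HilbertForm_eq_dotProduct, smul_dotProduct, smul_eq_mul]

/-! ### `x ∈ T_x ⊗ ℂ`: orthogonals commute with `⊗ ℂ` -/

/-- **`dim_ℂ (R ⊗ ℂ) = dim_ℚ R`** for a `ℚ`-subspace `R ⊆ Λ_ℚ` (a `ℚ`-basis stays `ℂ`-linearly
independent, `linearIndependent_algebraMap_comp_iff`). [folklore] -/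
theorem finrank_span_ratCast (R : Submodule ℚ (K3Index → ℚ)) :
    finrank ℂ (Submodule.span ℂ
      ((fun a : K3Index → ℚ => fun i => (a i : ℂ)) '' (R : Set (K3Index → ℚ)))) = finrank ℚ R := by
  -- adapted from `finrank_span_ratCast_image`
  -- (Literature/AlgebraicGeometry/Surfaces/VanGeemenSarti2007ExistsNikulinK3PicardNineZarhinProofs)
  classical
  let b := Module.finBasis ℚ R
  let f : Fin (finrank ℚ R) → K3Index → ℂ := fun k i => (((b k : R) : K3Index → ℚ) i : ℂ)
  have hli : LinearIndependent ℂ f := by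
    have hb : LinearIndependent ℚ fun k => ((b k : R) : K3Index → ℚ) :=
      b.linearIndependent.map' R.subtype (Submodule.ker_subtype R)
    have h := (linearIndependent_algebraMap_comp_iff (S := ℂ)).2 hb
    have hf : f = fun k => ⇑(algebraMap ℚ ℂ) ∘ ((b k : R) : K3Index → ℚ) := by
      funext k i
      simp only [f, Function.comp_apply, eq_ratCast]
    rw [hf]
    exact h
  have hspan : Submodule.span ℂ ((fun a : K3Index → ℚ => fun i => (a i : ℂ)) ''
      (R : Set (K3Index → ℚ))) = Submodule.span ℂ (Set.range f) := by
    apply le_antisymm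
    · refine Submodule.span_le.2 ?_
      rintro _ ⟨a, ha, rfl⟩
      have ha' : (⟨a, ha⟩ : R) = ∑ k, b.repr ⟨a, ha⟩ k • b k := (b.sum_repr _).symm
      have hc : (fun i => (a i : ℂ)) = ∑ k, (b.repr ⟨a, ha⟩ k : ℂ) • f k := by
        have h2 := congrArg (fun r : R => fun i => (((r : R) : K3Index → ℚ) i : ℂ)) ha'
        simp only at h2
        rw [h2]
        funext i
        simp only [f, Submodule.coe_sum, Submodule.coe_smul, Finset.sum_apply, Pi.smul_apply,
          Rat.cast_sum, Rat.cast_mul, smul_eq_mul]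
      show (fun i => (a i : ℂ)) ∈ Submodule.span ℂ (Set.range f)
      rw [hc]
      exact Submodule.sum_mem _ fun k _ =>
        Submodule.smul_mem _ _ (Submodule.subset_span ⟨k, rfl⟩)
    · refine Submodule.span_mono ?_
      rintro _ ⟨k, rfl⟩
      exact ⟨((b k : R) : K3Index → ℚ), (b k).2, rfl⟩
  rw [hspan, finrank_span_eq_card hli, Fintype.card_fin]

/-- **A period lies in its complexified rational transcendental space**: `x ∈ T_x ⊗ ℂ`, where
`T_x = N_x^⊥ ⊂ Λ_ℚ` and `N_x = x^⊥ ∩ Λ_ℚ`.  Indeed `T_x ⊗ ℂ ⊆ (N_x ⊗ ℂ)^⊥ ∋ x`, and both have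
dimension `22 − dim N_x` (the K3 form is non-degenerate over `ℚ` and over `ℂ`, `det Λ_{K3} = −1`).
[cite: Huybrechts2016K3, Ch. 3 Def. 2.5 and Lemma 3.1] -/
theorem mem_span_trRat (x : K3Index → ℂ) :
    x ∈ Submodule.span ℂ
      ((fun a : K3Index → ℚ => fun i => (a i : ℂ)) '' (trRat x : Set (K3Index → ℚ))) := by
  set c : (K3Index → ℚ) → K3Index → ℂ := fun a i => (a i : ℂ) with hc
  set NC := Submodule.span ℂ (c '' (nsRat x : Set (K3Index → ℚ))) with hNC
  have horth : ∀ y : K3Index → ℂ, (∀ v ∈ nsRat x, k3Form (c v) y = 0) →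
      y ∈ k3FormC.orthogonal NC := by
    intro y hy
    rw [LinearMap.BilinForm.mem_orthogonal_iff]
    intro n hn
    have hle : NC ≤ LinearMap.ker (k3FormC.flip y) := by
      refine Submodule.span_le.2 ?_
      rintro _ ⟨v, hv, rfl⟩
      rw [SetLike.mem_coe, LinearMap.mem_ker]
      show k3FormC (c v) y = 0
      rw [k3FormC_apply]
      exact hy v hv
    exact hle hn
  have hTle : Submodule.span ℂ (c '' (trRat x : Set (K3Index → ℚ))) ≤ k3FormC.orthogonal NC := by
    refine Submodule.span_le.2 ?_
    rintro _ ⟨t, ht, rfl⟩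
    exact horth _ fun v hv => by rw [k3Form_ratCast, (mem_trRat.1 ht) v hv, Rat.cast_zero]
  have hCn : k3FormC.Nondegenerate := by
    refine LinearMap.BilinForm.nondegenerate_toBilin'_of_det_ne_zero' _ ?_
    rw [← Int.cast_det, k3Gram_det]
    norm_num
  have hfin : finrank ℂ (k3FormC.orthogonal NC) ≤
      finrank ℂ (Submodule.span ℂ (c '' (trRat x : Set (K3Index → ℚ)))) := by
    rw [LinearMap.BilinForm.finrank_orthogonal hCn, hNC, finrank_span_ratCast,
      finrank_span_ratCast, trRat, LinearMap.BilinForm.finrank_orthogonal k3FormRat_nondegenerate,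
      finrank_k3Rat, Module.finrank_fintype_fun_eq_card]
    exact le_of_eq (by simp [K3Index])
  rw [Submodule.eq_of_le_of_finrank_le hTle hfin]
  exact horth x fun v hv => mem_nsRat.1 hv

end Summit.HodgeConjecture.HodgeConjecture.Theorems.NikulinTwinTransport.HkLatticeWitt

end
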